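import Summits.HodgeConjecture.HodgeConjecture.Theorems.Ring2WeilCoverageLatticeNormTwist
import Summits.HodgeConjecture.HodgeConjecture.Theorems.Ring2WeilCoverageCyclotomicSignaturesG12B
import Summits.HodgeConjecture.HodgeConjecture.Theorems.Ring2WeilCoverageRealQuadraticUnitNorm
import HarnessLib

/-!
# Weil-type family coverage — level `M = 52`, the NON-PRINCIPAL lattice classes: the prime `𝔔 = (1 − ζ⁴, 3 + 2ζ¹³)` over `13`
# has `𝔔𝔔^ρ = (1 − ζ⁴) = (α)` with `α = u(2,4,49)·u(1,7,48)·u(11,17,38)·u(21,23,30)` TOTALLY POSITIVE, so `ℂ^Φ/Φ(𝔔)` and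
# `ℂ^Φ/Φ(𝔔^ρ)` repeat the verdict of `ℤ[ζ₅₂]`: every `K`-balanced CM type is principally polarisable on all three classes

research route conditional on HC_CM; not a corollary; Q11.4-sentence-2 already refuted in dim ≥ 3.

Ring 2, WEIL-TYPE FAMILY-COVERAGE CENSUS (`HOME/WEIL-FAMILY-COVERAGE.md` `## b01`, block b01.40 (C) «the `h = 3` levels `52/72`:
all three lattice classes repeat the principal verdict — GIVEN the printed `h⁺ = 1`», owner ring2-b01), part 46 of the
`Ring2WeilCoverage*` series.  This file removes the class-field-theory pencil step at `52`: it EXHIBITS the norm generator.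
`h(ℚ(ζ₅₂)) = 3` [Washington1997, tables §11]; the two primes over `13` are complex conjugate and (PARI `bnfisprincipal`, job
j214838 of this seat; GRH-conditional class group, printed class number) represent the two non-trivial classes.  Kernel content:

* §1 the element `α = ∏_{x ∈ A} u(x)`, `u(a,b,h) = ζ^h(1 − ζ^a)(1 − ζ^b)` (part 13's real normalisation `2h + a + b = 104`),
  `A = {(2,4,49), (1,7,48), (11,17,38), (21,23,30)}`: by part 13's `re_embedding_prod_neg_iff` and a `decide`d parity table,
  **`Re σ(α) > 0` at EVERY embedding** and `α^ρ = α` (`alpha_pos`, `alpha_real`).  The only non-unit factor is `1 − ζ⁴`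
  (`ζ⁴` of order `13`); `1 − ζ²`, `1 − ζ`, `1 − ζ⁷`, … have orders `26, 52, …` (not prime powers) and are units (part 13).
* §2 the lattice: `𝔔 = (1 − ζ⁴, 3 + 2ζ¹³)` (`13 = (3 + 2i)(3 − 2i)`, `i = ζ¹³`), `𝔔^ρ = (1 − ζ⁴⁸, 3 + 2ζ³⁹)`,
  **`𝔔𝔔^ρ = (1 − ζ⁴)`** (`span_mul_span_conj_eq`: the four products are `(1 − ζ⁴)`-multiples — `13 = (1 − ζ⁴)·q₄` included — and
  `1 − ζ⁴ = −3ζ¹³·(1 − ζ⁴)(3 + 2ζ³⁹) − ζ⁴(3 + ζ¹³)·(3 + 2ζ¹³)(1 − ζ⁴⁸)`; `linear_combination`s mod `(1 + ζ²⁶, Σ_{k<13} ζ^{4k}, ζ⁵² − 1)`,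
  certificates `g60/py52/cert5272.py`; `span_mul_span_conj_eq`), and `(α) = (1 − ζ⁴)` (`span_alpha_eq`, the cofactor is a unit).
* §3 **`principal_iff_of_mul_conjIdeal_eq`**: for ANY lattice `𝔪` with `𝔪𝔪^ρ = (α)` and any CM type `Φ`, `ℂ^Φ/D(𝔪)` carries an
  `ι`-compatible principal polarisation iff `ℂ^Φ/Φ(ℤ[ζ₅₂])` does (part 42 with `Φ_α = Φ`); specialised to `𝔪 = 𝔔` and
  `𝔪 = 𝔔^ρ` (`principal_iff_fiftyTwo_nonprincipal`, `…_conj`); and the two census rows `(52, ℚ(i))`, `(52, ℚ(√−13))` ON `𝔔`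
  AND ON `𝔔^ρ`: **YES for every `K`-balanced CM type** (part 23's `exists_principal_fiftyTwo_…` transported).

HONEST FRAMING: statements about Shimura's divisors of principal type on the principal CM tori `ℂ^Φ/D(𝔪)` with `𝔪𝔪^ρ = (α)`,
elementary ideal arithmetic in `ℤ[ζ₅₂]` and sign combinatorics; that `{ℤ[ζ₅₂], 𝔔, 𝔔^ρ}` represent ALL lattice classes is
`h = 3` (printed) + `[𝔔] ≠ 1` (PARI) and is NOT proved here; nothing about Hodge classes, `W_K`, general members or HC; `HC_CM` is
used nowhere.  No `def`, no named fact, no `sorry`.  References: [cite: Shimura1998, §14.3 Prop. 4–5, pp. 103–104; §14.4 Prop. 7,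
p. 105]; [cite: Washington1997, §8.1, Prop. 2.8, tables §11]; census b01.36, b01.40 (seat-derived).
-/

noncomputable section

open Polynomial NumberField NumberField.ComplexEmbedding Complex Finset FractionalIdeal
open scoped nonZeroDivisors Real

namespace Summit.HodgeConjecture.Ring2WeilCoverage.NonPrincipalLatticeLevel52

open Literature.AlgebraicGeometry.Motives (CMType)
open Literature.AlgebraicGeometry.ComplexMultiplication.CyclotomicCMType
open Literature.NumberTheory.ComplexMultiplication
open Literature.NumberTheory.NumberFields
open Summit.HodgeConjecture.Ring2WeilCoverage.LatticeNormTwist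
open Summit.HodgeConjecture.Ring2WeilCoverage.CyclotomicUnitProducts
  (re_embedding_gen re_embedding_prod_neg_iff isUnit_one_sub_toInteger_pow)
open Summit.HodgeConjecture.Ring2WeilCoverage.CyclotomicSignaturesG12B
  (exists_principal_fiftyTwo_sqrt_neg_one exists_principal_fiftyTwo_sqrt_neg_thirteen)
open Summit.HodgeConjecture.Ring2WeilCoverage.RealQuadraticUnitNorm (complexConj_eq_inv_of_pow_eq_one)

variable {K : Type} [Field K] [NumberField K] [IsCMField K] {ζ : K}

/-- `𝐞(t) = exp(2πi t/52) ∈ ℂ` (`ZMod.toCircle`). -/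
local notation3 (prettyPrint := false) "𝐞 " t:max => ((ZMod.toCircle t : Circle) : ℂ)
/-- part 13's generator `u(x) = ζ^h(1 − ζ^a)(1 − ζ^b)` for `x = (a, b, h)`. -/
local notation3 (prettyPrint := false) "𝐮 " x:max =>
  (ζ ^ (x : ℕ × ℕ × ℕ).2.2 * (1 - ζ ^ (x : ℕ × ℕ × ℕ).1) * (1 - ζ ^ (x : ℕ × ℕ × ℕ).2.1))
/-- the sign predicate of `u(x)` at the unit residue `t` (part 13). -/
local notation3 (prettyPrint := false) "negAt " x:max t:max =>
  (52 < (x : ℕ × ℕ × ℕ).1 * ZMod.val t % (2 * 52) ↔ 52 < (x : ℕ × ℕ × ℕ).2.1 * ZMod.val t % (2 * 52))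
/-- the four triples of `α`. -/
local notation3 (prettyPrint := false) "A52" => ({(2, 4, 49), (1, 7, 48), (11, 17, 38), (21, 23, 30)} : Finset (ℕ × ℕ × ℕ))
/-- `α = u(2,4,49)·u(1,7,48)·u(11,17,38)·u(21,23,30)` written out. -/
local notation3 (prettyPrint := false) "α" =>
  (ζ ^ 49 * (1 - ζ ^ 2) * (1 - ζ ^ 4) * (ζ ^ 48 * (1 - ζ ^ 1) * (1 - ζ ^ 7) *
    (ζ ^ 38 * (1 - ζ ^ 11) * (1 - ζ ^ 17) * (ζ ^ 30 * (1 - ζ ^ 21) * (1 - ζ ^ 23)))))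
/-- the lattice `𝔔 = (1 − ζ⁴, 3 + 2ζ¹³) ⊂ 𝓞 K` (a prime over `13`). -/
local notation3 (prettyPrint := false) "𝔔[" hζ "]" =>
  (Ideal.span {1 - IsPrimitiveRoot.toInteger hζ ^ 4, 3 + 2 * IsPrimitiveRoot.toInteger hζ ^ 13} : Ideal (𝓞 K))
/-- its conjugate `𝔔^ρ = (1 − ζ⁴⁸, 3 + 2ζ³⁹)`. -/
local notation3 (prettyPrint := false) "𝔔ρ[" hζ "]" =>
  (Ideal.span {1 - IsPrimitiveRoot.toInteger hζ ^ 48, 3 + 2 * IsPrimitiveRoot.toInteger hζ ^ 39} : Ideal (𝓞 K))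

/-! ### §1 The totally positive element `α` -/

omit [NumberField K] [IsCMField K] in
/-- `∏_{x ∈ A} u(x) = α` (the written-out product). [folklore] -/
theorem prod_A52_eq : (∏ x ∈ A52, 𝐮 x) = α := by
  rw [Finset.prod_insert (by decide), Finset.prod_insert (by decide), Finset.prod_insert (by decide),
    Finset.prod_singleton]

/-- The `decide`d data: the four triples satisfy part 13's side conditions (`52 ∤ a, b`, `2h + a + b ≡ 0 (mod 104)`), and at
every unit residue `t` an EVEN number of the four factors is negative. [folklore] -/
theorem A52_facts :
    (∀ x ∈ A52, ¬ 52 ∣ x.1 ∧ ¬ 52 ∣ x.2.1 ∧ (2 * x.2.2 + x.1 + x.2.1) % (2 * 52) = 0) ∧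
    (∀ t : ZMod 52, t.val.Coprime 52 → Even ((Finset.filter (fun x => negAt x t) A52).card)) := by
  refine ⟨by decide, by decide⟩

omit [NumberField K] [IsCMField K] in
/-- **`Re σ(α) > 0` and `Im σ(α) = 0`** whenever `σ ζ = 𝐞(t)`, `t` a unit residue (part 13's signed-product read + the table).
research route conditional on HC_CM; not a corollary; Q11.4-sentence-2 already refuted in dim ≥ 3. [cite: Washington1997, §8.1] -/
theorem alpha_read {σ : K →+* ℂ} {t : ZMod 52} (ht : t.val.Coprime 52) (hσ : σ ζ = 𝐞 t) :
    0 < (σ α).re ∧ (σ α).im = 0 := by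
  obtain ⟨hA, hev⟩ := A52_facts
  obtain ⟨hneg, hne⟩ := re_embedding_prod_neg_iff (n := 52) hσ ht A52 hA false
  simp only [Bool.false_eq_true, ↓reduceIte, one_mul, add_zero] at hneg hne
  rw [prod_A52_eq] at hneg hne
  have him : ∀ x ∈ A52, (σ (𝐮 x)).im = 0 := fun x hx =>
    (re_embedding_gen hσ ht (hA x hx).1 (hA x hx).2.1 (hA x hx).2.2).2.2
  have hreal : ∀ x ∈ A52, σ (𝐮 x) = (((σ (𝐮 x)).re : ℝ) : ℂ) := fun x hx =>
    Complex.ext (by simp) (by rw [Complex.ofReal_im]; exact him x hx)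
  have hprod : σ α = ((∏ x ∈ A52, (σ (𝐮 x)).re : ℝ) : ℂ) := by
    rw [← prod_A52_eq, map_prod, Complex.ofReal_prod]
    exact Finset.prod_congr rfl hreal
  exact ⟨lt_of_le_of_ne (not_lt.mp fun h => (Nat.not_odd_iff_even.mpr (hev t ht)) (hneg.mp h)) hne.symm,
    by rw [hprod, Complex.ofReal_im]⟩

/-- **`α ∈ ℚ(ζ₅₂)⁺` and `α` is TOTALLY POSITIVE**: `α^ρ = α` and `Re φ(α) > 0` for every embedding `φ`.
research route conditional on HC_CM; not a corollary; Q11.4-sentence-2 already refuted in dim ≥ 3. [folklore] -/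
theorem alpha_real_pos (hζ : IsPrimitiveRoot ζ 52) :
    IsCMField.complexConj K α = α ∧ ∀ φ : K →+* ℂ, 0 < (φ α).re := by
  refine ⟨?_, fun φ => ?_⟩
  · obtain ⟨φ⟩ := (inferInstance : Nonempty (K →+* ℂ))
    obtain ⟨t, ht, hφ⟩ := exists_apply_eq_toCircle hζ φ
    obtain ⟨-, him⟩ := alpha_read ht hφ
    apply φ.injective
    rw [IsCMField.complexEmbedding_complexConj]
    exact Complex.ext (by rw [Complex.conj_re]) (by rw [Complex.conj_im, him, neg_zero])
  · obtain ⟨t, ht, hφ⟩ := exists_apply_eq_toCircle hζ φ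
    exact (alpha_read ht hφ).1

/-! ### §2 The lattice `𝔔 = (1 − ζ⁴, 3 + 2ζ¹³)`: `𝔔𝔔^ρ = (1 − ζ⁴) = (α)` -/

section Lattice

omit [NumberField K] [IsCMField K] in
/-- The cyclotomic relations at `52`: `1 + ζ²⁶ = 0`, `Σ_{k<13} ζ^{4k} = 0`, `ζ⁵² = 1`. [folklore] -/
theorem relations_fiftyTwo (hζ : IsPrimitiveRoot ζ 52) :
    1 + ζ ^ 26 = 0 ∧
    1 + ζ ^ 4 + ζ ^ 8 + ζ ^ 12 + ζ ^ 16 + ζ ^ 20 + ζ ^ 24 + ζ ^ 28 + ζ ^ 32 + ζ ^ 36 + ζ ^ 40 + ζ ^ 44 + ζ ^ 48 = 0 ∧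
    ζ ^ 52 = 1 := by
  have h52 : ζ ^ 52 = 1 := hζ.pow_eq_one
  have h2 := (hζ.pow (by norm_num) (show 52 = 26 * 2 by norm_num)).eq_neg_one_of_two_right
  have hη : IsPrimitiveRoot (ζ ^ 4) 13 := hζ.pow (by norm_num) (by norm_num)
  have hB := hη.geom_sum_eq_zero (by norm_num : 1 < 13)
  simp only [Finset.sum_range_succ, Finset.sum_range_zero, zero_add, ← pow_mul] at hB
  exact ⟨by linear_combination h2, by linear_combination hB, h52⟩

/-- `ζ^ρ = ζ⁵¹` (complex conjugation inverts the root of unity). [folklore] -/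
theorem complexConj_zeta (hζ : IsPrimitiveRoot ζ 52) : IsCMField.complexConj K ζ = ζ ^ 51 := by
  have h52 : ζ ^ 52 = 1 := hζ.pow_eq_one
  rw [complexConj_eq_inv_of_pow_eq_one (by norm_num) h52]
  exact inv_eq_of_mul_eq_one_right (by linear_combination h52)

/-- **`𝔔^ρ = (1 − ζ⁴⁸, 3 + 2ζ³⁹)`**: the image of `𝔔` under `ρ` restricted to `𝓞 K` (`ζ^ρ = ζ⁵¹`). [folklore] -/
theorem map_conj_span_eq (hζ : IsPrimitiveRoot ζ 52) :
    (𝔔[hζ]).map (AmbiguousClass.intAut (IsCMField.complexConj K) : 𝓞 K →+* 𝓞 K) = 𝔔ρ[hζ] := by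
  obtain ⟨-, -, hM⟩ := relations_fiftyTwo hζ
  have hc := complexConj_zeta hζ
  have hzK : algebraMap (𝓞 K) K hζ.toInteger = ζ := rfl
  have h4 : (ζ ^ 51) ^ 4 = ζ ^ 48 := by
    rw [← pow_mul, show 51 * 4 = 52 * 3 + 48 by norm_num, pow_add, pow_mul, hM, one_pow, one_mul]
  have h13 : (ζ ^ 51) ^ 13 = ζ ^ 39 := by
    rw [← pow_mul, show 51 * 13 = 52 * 12 + 39 by norm_num, pow_add, pow_mul, hM, one_pow, one_mul]
  have h1 : (AmbiguousClass.intAut (IsCMField.complexConj K) : 𝓞 K →+* 𝓞 K) (1 - hζ.toInteger ^ 4) =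
      1 - hζ.toInteger ^ 48 := by
    apply RingOfIntegers.ext
    change IsCMField.complexConj K ((1 - hζ.toInteger ^ 4 : 𝓞 K) : K) = ((1 - hζ.toInteger ^ 48 : 𝓞 K) : K)
    push_cast
    simp only [map_sub, map_one, map_pow, hzK, hc, h4]
  have h2 : (AmbiguousClass.intAut (IsCMField.complexConj K) : 𝓞 K →+* 𝓞 K) (3 + 2 * hζ.toInteger ^ 13) =
      3 + 2 * hζ.toInteger ^ 39 := by
    apply RingOfIntegers.ext
    change IsCMField.complexConj K ((3 + 2 * hζ.toInteger ^ 13 : 𝓞 K) : K) = ((3 + 2 * hζ.toInteger ^ 39 : 𝓞 K) : K)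
    push_cast
    simp only [map_add, map_mul, map_ofNat, map_pow, hzK, hc, h13]
  rw [Ideal.map_span, Set.image_pair, h1, h2]

/-- **`(𝔔^ρ)^ρ = 𝔔`** (`ρ² = 1` on the generators: `(ζ⁵¹)⁴⁸ = ζ⁴`, `(ζ⁵¹)³⁹ = ζ¹³`). [folklore] -/
theorem map_conj_span_conj_eq (hζ : IsPrimitiveRoot ζ 52) :
    (𝔔ρ[hζ]).map (AmbiguousClass.intAut (IsCMField.complexConj K) : 𝓞 K →+* 𝓞 K) = 𝔔[hζ] := by
  obtain ⟨-, -, hM⟩ := relations_fiftyTwo hζ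
  have hc := complexConj_zeta hζ
  have hzK : algebraMap (𝓞 K) K hζ.toInteger = ζ := rfl
  have h48 : (ζ ^ 51) ^ 48 = ζ ^ 4 := by
    rw [← pow_mul, show 51 * 48 = 52 * 47 + 4 by norm_num, pow_add, pow_mul, hM, one_pow, one_mul]
  have h39 : (ζ ^ 51) ^ 39 = ζ ^ 13 := by
    rw [← pow_mul, show 51 * 39 = 52 * 38 + 13 by norm_num, pow_add, pow_mul, hM, one_pow, one_mul]
  have h1 : (AmbiguousClass.intAut (IsCMField.complexConj K) : 𝓞 K →+* 𝓞 K) (1 - hζ.toInteger ^ 48) =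
      1 - hζ.toInteger ^ 4 := by
    apply RingOfIntegers.ext
    change IsCMField.complexConj K ((1 - hζ.toInteger ^ 48 : 𝓞 K) : K) = ((1 - hζ.toInteger ^ 4 : 𝓞 K) : K)
    push_cast
    simp only [map_sub, map_one, map_pow, hzK, hc, h48]
  have h2 : (AmbiguousClass.intAut (IsCMField.complexConj K) : 𝓞 K →+* 𝓞 K) (3 + 2 * hζ.toInteger ^ 39) =
      3 + 2 * hζ.toInteger ^ 13 := by
    apply RingOfIntegers.ext
    change IsCMField.complexConj K ((3 + 2 * hζ.toInteger ^ 39 : 𝓞 K) : K) = ((3 + 2 * hζ.toInteger ^ 13 : 𝓞 K) : K)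
    push_cast
    simp only [map_add, map_mul, map_ofNat, map_pow, hzK, hc, h39]
  rw [Ideal.map_span, Set.image_pair, h1, h2]

omit [NumberField K] [IsCMField K] in
/-- **`𝔔𝔔^ρ = (1 − ζ⁴)` in `𝓞 K`**: the four products `(1 − ζ⁴)(1 − ζ⁴⁸)`, `(1 − ζ⁴)(3 + 2ζ³⁹)`, `(3 + 2ζ¹³)(1 − ζ⁴⁸)`,
`(3 + 2ζ¹³)(3 + 2ζ³⁹) = 13` are `(1 − ζ⁴)`-multiples (explicit quotients), and `1 − ζ⁴ = −3ζ¹³·g₂ − ζ⁴(3 + ζ¹³)·g₃`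
(certificates `g60/py52/cert5272.py`).
research route conditional on HC_CM; not a corollary; Q11.4-sentence-2 already refuted in dim ≥ 3. [folklore] -/
theorem span_mul_span_conj_eq (hζ : IsPrimitiveRoot ζ 52) :
    𝔔[hζ] * 𝔔ρ[hζ] = Ideal.span {1 - hζ.toInteger ^ 4} := by
  obtain ⟨hA, hB, hM⟩ := relations_fiftyTwo hζ
  have hzK : algebraMap (𝓞 K) K hζ.toInteger = ζ := rfl
  rw [Ideal.span_pair_mul_span_pair]
  apply le_antisymm
  · rw [Ideal.span_le]
    intro x hx
    simp only [Set.mem_insert_iff, Set.mem_singleton_iff] at hx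
    rw [SetLike.mem_coe, Ideal.mem_span_singleton]
    rcases hx with rfl | rfl | rfl | rfl
    · refine ⟨1 + hζ.toInteger ^ 22, RingOfIntegers.ext ?_⟩
      push_cast; simp only [hzK]
      linear_combination ((-1 : K) * ζ ^ 2 + (-1 : K) * ζ ^ 4 + (-1 : K) * ζ ^ 6 + (-1 : K) * ζ ^ 8 + (-1 : K) * ζ ^ 10 + (-1 : K) * ζ ^ 12 + (-1 : K) * ζ ^ 14 + (-1 : K) * ζ ^ 16 + (-1 : K) * ζ ^ 18 + (-1 : K) * ζ ^ 20 + (-1 : K) * ζ ^ 22 + (1 : K) * ζ ^ 26 + (1 : K) * ζ ^ 28 + (1 : K) * ζ ^ 30 + (1 : K) * ζ ^ 32 + (1 : K) * ζ ^ 34 + (1 : K) * ζ ^ 36 + (1 : K) * ζ ^ 38 + (1 : K) * ζ ^ 40 + (1 : K) * ζ ^ 42 + (1 : K) * ζ ^ 44 + (1 : K) * ζ ^ 46) * hA + ((1 : K) + (1 : K) * ζ ^ 2 + (-1 : K) * ζ ^ 22 + (-1 : K) * ζ ^ 24) * hB + ((1 : K)) * hM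
    · refine ⟨3 - 2 * hζ.toInteger ^ 13, RingOfIntegers.ext ?_⟩
      push_cast; simp only [map_ofNat, hzK]
      linear_combination ((-2 : K) * ζ ^ 15 + (-2 : K) * ζ ^ 17 + (2 : K) * ζ ^ 39 + (2 : K) * ζ ^ 41) * hA + ((2 : K) * ζ ^ 13 + (2 : K) * ζ ^ 15 + (-2 : K) * ζ ^ 17 + (-2 : K) * ζ ^ 19) * hB
    · refine ⟨-2 * hζ.toInteger ^ 9 + 3 * hζ.toInteger ^ 22, RingOfIntegers.ext ?_⟩
      push_cast; simp only [map_ofNat, hzK]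
      linear_combination ((-3 : K) * ζ ^ 2 + (-3 : K) * ζ ^ 4 + (-3 : K) * ζ ^ 6 + (-3 : K) * ζ ^ 8 + (-3 : K) * ζ ^ 10 + (-3 : K) * ζ ^ 12 + (-3 : K) * ζ ^ 14 + (-3 : K) * ζ ^ 16 + (-3 : K) * ζ ^ 18 + (-3 : K) * ζ ^ 20 + (-3 : K) * ζ ^ 22 + (3 : K) * ζ ^ 26 + (3 : K) * ζ ^ 28 + (3 : K) * ζ ^ 30 + (3 : K) * ζ ^ 32 + (3 : K) * ζ ^ 34 + (3 : K) * ζ ^ 36 + (3 : K) * ζ ^ 38 + (3 : K) * ζ ^ 40 + (3 : K) * ζ ^ 42 + (3 : K) * ζ ^ 44 + (3 : K) * ζ ^ 46) * hA + ((3 : K) + (3 : K) * ζ ^ 2 + (-3 : K) * ζ ^ 22 + (-3 : K) * ζ ^ 24) * hB + ((-2 : K) * ζ ^ 9) * hM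
    · refine ⟨6 + hζ.toInteger ^ 2 + 5 * hζ.toInteger ^ 4 + 2 * hζ.toInteger ^ 6 + 4 * hζ.toInteger ^ 8 +
        3 * hζ.toInteger ^ 10 + 3 * hζ.toInteger ^ 12 + 4 * hζ.toInteger ^ 14 + 2 * hζ.toInteger ^ 16 +
        5 * hζ.toInteger ^ 18 + hζ.toInteger ^ 20 + 6 * hζ.toInteger ^ 22, RingOfIntegers.ext ?_⟩
      push_cast; simp only [map_ofNat, hzK]
      linear_combination ((-7 : K) * ζ ^ 2 + (-6 : K) * ζ ^ 4 + (-7 : K) * ζ ^ 6 + (-6 : K) * ζ ^ 8 + (-7 : K) * ζ ^ 10 + (-6 : K) * ζ ^ 12 + (-7 : K) * ζ ^ 14 + (-6 : K) * ζ ^ 15 + (-6 : K) * ζ ^ 16 + (-6 : K) * ζ ^ 17 + (-7 : K) * ζ ^ 18 + (-6 : K) * ζ ^ 19 + (-6 : K) * ζ ^ 20 + (-6 : K) * ζ ^ 21 + (-7 : K) * ζ ^ 22 + (-6 : K) * ζ ^ 23 + (-6 : K) * ζ ^ 24 + (-6 : K) * ζ ^ 25 + (-6 : K) * ζ ^ 27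 + (-6 : K) * ζ ^ 29 + (-6 : K) * ζ ^ 31 + (-6 : K) * ζ ^ 33 + (-6 : K) * ζ ^ 35 + (-6 : K) * ζ ^ 37) * hA + ((7 : K) + (6 : K) * ζ ^ 2 + (6 : K) * ζ ^ 13 + (6 : K) * ζ ^ 15) * hB + ((4 : K)) * hM
  · rw [Ideal.span_singleton_le_iff_mem]
    have heq : (1 - hζ.toInteger ^ 4 : 𝓞 K) =
        (-3 * hζ.toInteger ^ 13) * ((1 - hζ.toInteger ^ 4) * (3 + 2 * hζ.toInteger ^ 39)) +
          (-(hζ.toInteger ^ 4 * (3 + hζ.toInteger ^ 13))) * ((3 + 2 * hζ.toInteger ^ 13) * (1 - hζ.toInteger ^ 48)) := by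
      apply RingOfIntegers.ext
      push_cast; simp only [map_ofNat, hzK]
      linear_combination ((2 : K) * ζ ^ 2 + (2 : K) * ζ ^ 4 + (-2 : K) * ζ ^ 26 + (-2 : K) * ζ ^ 28) * hA + ((-2 : K) + (-2 : K) * ζ ^ 2 + (2 : K) * ζ ^ 4 + (2 : K) * ζ ^ 6) * hB + ((-3 : K) + (-6 : K) * ζ ^ 4 + (-9 : K) * ζ ^ 13 + (-2 : K) * ζ ^ 26) * hM
    have hmem := Ideal.add_mem _
      (Ideal.mul_mem_left _ (-3 * hζ.toInteger ^ 13)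
        (Ideal.subset_span (s := ({(1 - hζ.toInteger ^ 4) * (1 - hζ.toInteger ^ 48),
          (1 - hζ.toInteger ^ 4) * (3 + 2 * hζ.toInteger ^ 39), (3 + 2 * hζ.toInteger ^ 13) * (1 - hζ.toInteger ^ 48),
          (3 + 2 * hζ.toInteger ^ 13) * (3 + 2 * hζ.toInteger ^ 39)} : Set (𝓞 K)))
          (a := (1 - hζ.toInteger ^ 4) * (3 + 2 * hζ.toInteger ^ 39)) (by simp)))
      (Ideal.mul_mem_left _ (-(hζ.toInteger ^ 4 * (3 + hζ.toInteger ^ 13)))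
        (Ideal.subset_span (s := ({(1 - hζ.toInteger ^ 4) * (1 - hζ.toInteger ^ 48),
          (1 - hζ.toInteger ^ 4) * (3 + 2 * hζ.toInteger ^ 39), (3 + 2 * hζ.toInteger ^ 13) * (1 - hζ.toInteger ^ 48),
          (3 + 2 * hζ.toInteger ^ 13) * (3 + 2 * hζ.toInteger ^ 39)} : Set (𝓞 K)))
          (a := (3 + 2 * hζ.toInteger ^ 13) * (1 - hζ.toInteger ^ 48)) (by simp)))
    rw [← heq] at hmem
    exact hmem

omit [NumberField K] [IsCMField K] in
/-- **`(α) = (1 − ζ⁴)`**: `α = (1 − ζ⁴)·w` with `w = ζ⁴⁹(1 − ζ²)·u(1,7,48)·u(11,17,38)·u(21,23,30)` a unit (part 13: the orders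
`26, 52, 52, 52, 52, 52, 52` of `ζ², ζ, ζ⁷, ζ¹¹, ζ¹⁷, ζ²¹, ζ²³` are not prime powers). [cite: Washington1997, Prop. 2.8] -/
theorem span_alpha_eq (hζ : IsPrimitiveRoot ζ 52) :
    Ideal.span {(hζ.toInteger ^ 49 * (1 - hζ.toInteger ^ 2) * (1 - hζ.toInteger ^ 4) *
        (hζ.toInteger ^ 48 * (1 - hζ.toInteger ^ 1) * (1 - hζ.toInteger ^ 7) *
          (hζ.toInteger ^ 38 * (1 - hζ.toInteger ^ 11) * (1 - hζ.toInteger ^ 17) *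
            (hζ.toInteger ^ 30 * (1 - hζ.toInteger ^ 21) * (1 - hζ.toInteger ^ 23)))) : 𝓞 K)} =
      Ideal.span {1 - hζ.toInteger ^ 4} := by
  have hz : IsUnit (hζ.toInteger : 𝓞 K) := hζ.toInteger_isPrimitiveRoot.isUnit (by norm_num)
  have hu : ∀ a : ℕ, ¬ 52 ∣ a → ¬ IsPrimePow (52 / Nat.gcd 52 a) → IsUnit (1 - hζ.toInteger ^ a : 𝓞 K) :=
    fun a ha hnp => isUnit_one_sub_toInteger_pow hζ ha hnp
  have hw : IsUnit (hζ.toInteger ^ 49 * (1 - hζ.toInteger ^ 2) *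
      (hζ.toInteger ^ 48 * (1 - hζ.toInteger ^ 1) * (1 - hζ.toInteger ^ 7) *
        (hζ.toInteger ^ 38 * (1 - hζ.toInteger ^ 11) * (1 - hζ.toInteger ^ 17) *
          (hζ.toInteger ^ 30 * (1 - hζ.toInteger ^ 21) * (1 - hζ.toInteger ^ 23)))) : 𝓞 K) :=
    ((hz.pow 49).mul (hu 2 (by decide) (by decide))).mul
      ((((hz.pow 48).mul (hu 1 (by decide) (by decide))).mul (hu 7 (by decide) (by decide))).mul
        ((((hz.pow 38).mul (hu 11 (by decide) (by decide))).mul (hu 17 (by decide) (by decide))).mul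
          (((hz.pow 30).mul (hu 21 (by decide) (by decide))).mul (hu 23 (by decide) (by decide)))))
  rw [show (hζ.toInteger ^ 49 * (1 - hζ.toInteger ^ 2) * (1 - hζ.toInteger ^ 4) *
        (hζ.toInteger ^ 48 * (1 - hζ.toInteger ^ 1) * (1 - hζ.toInteger ^ 7) *
          (hζ.toInteger ^ 38 * (1 - hζ.toInteger ^ 11) * (1 - hζ.toInteger ^ 17) *
            (hζ.toInteger ^ 30 * (1 - hζ.toInteger ^ 21) * (1 - hζ.toInteger ^ 23)))) : 𝓞 K) =
      (1 - hζ.toInteger ^ 4) * (hζ.toInteger ^ 49 * (1 - hζ.toInteger ^ 2) *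
        (hζ.toInteger ^ 48 * (1 - hζ.toInteger ^ 1) * (1 - hζ.toInteger ^ 7) *
          (hζ.toInteger ^ 38 * (1 - hζ.toInteger ^ 11) * (1 - hζ.toInteger ^ 17) *
            (hζ.toInteger ^ 30 * (1 - hζ.toInteger ^ 21) * (1 - hζ.toInteger ^ 23))))) by ring]
  exact Ideal.span_singleton_mul_right_unit hw _

/-- **`𝔔𝔔^ρ = (α)` as fractional ideals**, for any invertible `𝔪` equal to `𝔔`. [folklore] -/
theorem mul_conjIdeal_eq_of_coe_eq (hζ : IsPrimitiveRoot ζ 52) (𝔪 : (FractionalIdeal (𝓞 K)⁰ K)ˣ)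
    (h : (𝔪 : FractionalIdeal (𝓞 K)⁰ K) = ((𝔔[hζ] : Ideal (𝓞 K)) : FractionalIdeal (𝓞 K)⁰ K)) :
    (𝔪 : FractionalIdeal (𝓞 K)⁰ K) * (CMTypeLattice.conjIdeal 𝔪 : FractionalIdeal (𝓞 K)⁰ K) = spanSingleton (𝓞 K)⁰ α := by
  rw [CMTypeLattice.coe_conjIdeal, h, AmbiguousClass.fracIdealAut, AmbiguousClass.ringEquivOfRingEquiv_coeIdeal,
    ← coeIdeal_mul, map_conj_span_eq hζ, span_mul_span_conj_eq hζ, ← span_alpha_eq hζ, coeIdeal_span_singleton]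
  rfl

/-- **`𝔔^ρ(𝔔^ρ)^ρ = (α)`** too (`ρ² = 1`): for any invertible `𝔪` equal to `𝔔^ρ`. [folklore] -/
theorem mul_conjIdeal_eq_of_coe_eq_conj (hζ : IsPrimitiveRoot ζ 52) (𝔪 : (FractionalIdeal (𝓞 K)⁰ K)ˣ)
    (h : (𝔪 : FractionalIdeal (𝓞 K)⁰ K) = ((𝔔ρ[hζ] : Ideal (𝓞 K)) : FractionalIdeal (𝓞 K)⁰ K)) :
    (𝔪 : FractionalIdeal (𝓞 K)⁰ K) * (CMTypeLattice.conjIdeal 𝔪 : FractionalIdeal (𝓞 K)⁰ K) = spanSingleton (𝓞 K)⁰ α := by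
  rw [CMTypeLattice.coe_conjIdeal, h, AmbiguousClass.fracIdealAut, AmbiguousClass.ringEquivOfRingEquiv_coeIdeal,
    ← coeIdeal_mul, map_conj_span_conj_eq hζ, mul_comm, span_mul_span_conj_eq hζ, ← span_alpha_eq hζ,
    coeIdeal_span_singleton]
  rfl

omit [IsCMField K] in
/-- **`𝔔` and `𝔔^ρ` are invertible lattices** (`𝔔𝔔^ρ ∋ 1 − ζ⁴ ≠ 0`). [folklore] -/
theorem exists_units_coe_eq (hζ : IsPrimitiveRoot ζ 52) :
    (∃ 𝔪 : (FractionalIdeal (𝓞 K)⁰ K)ˣ, (𝔪 : FractionalIdeal (𝓞 K)⁰ K) = ((𝔔[hζ] : Ideal (𝓞 K)) : FractionalIdeal (𝓞 K)⁰ K)) ∧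
    (∃ 𝔪 : (FractionalIdeal (𝓞 K)⁰ K)ˣ, (𝔪 : FractionalIdeal (𝓞 K)⁰ K) = ((𝔔ρ[hζ] : Ideal (𝓞 K)) : FractionalIdeal (𝓞 K)⁰ K)) := by
  have h4 : (1 - hζ.toInteger ^ 4 : 𝓞 K) ≠ 0 := by
    intro h0
    have h' := congrArg (fun x : 𝓞 K => (x : K)) h0
    have hzK : algebraMap (𝓞 K) K hζ.toInteger = ζ := rfl
    push_cast at h'
    simp only [hzK] at h'
    exact (hζ.pow (by norm_num) (show 52 = 4 * 13 by norm_num)).ne_one (by norm_num) (sub_eq_zero.mp h').symm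
  have hprod : 𝔔[hζ] * 𝔔ρ[hζ] ≠ ⊥ := by
    rw [span_mul_span_conj_eq hζ, Ne, Ideal.span_singleton_eq_bot]; exact h4
  have hQ : (𝔔[hζ] : Ideal (𝓞 K)) ≠ ⊥ := fun hb => hprod (by rw [hb, Ideal.bot_mul])
  have hQ' : (𝔔ρ[hζ] : Ideal (𝓞 K)) ≠ ⊥ := fun hb => hprod (by rw [hb, Ideal.mul_bot])
  exact ⟨⟨Units.mk0 _ (coeIdeal_ne_zero.mpr hQ), rfl⟩, ⟨Units.mk0 _ (coeIdeal_ne_zero.mpr hQ'), rfl⟩⟩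

end Lattice

/-! ### §3 The verdict repeats: every lattice with `𝔪𝔪^ρ = (α)` behaves like `ℤ[ζ₅₂]` -/

/-- **THE NON-PRINCIPAL CLASSES AT `52` REPEAT THE PRINCIPAL VERDICT.**  For any `K` with `[IsCMField K]` holding a primitive 52nd
root of unity `ζ`, ANY lattice `𝔪` with `𝔪𝔪^ρ = (α)` and any CM type `Φ`: `ℂ^Φ/D(𝔪)` carries an `ι`-compatible principal
polarisation iff `ℂ^Φ/Φ(𝓞_K)` does (part 42's twist principle with `Φ_α = Φ`, `α ≫ 0`).
research route conditional on HC_CM; not a corollary; Q11.4-sentence-2 already refuted in dim ≥ 3. [cite: Shimura1998, §14.4 Prop. 7, p. 105] -/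
theorem principal_iff_of_mul_conjIdeal_eq (hζ : IsPrimitiveRoot ζ 52) (Φ : CMType K) (𝔪 : (FractionalIdeal (𝓞 K)⁰ K)ˣ)
    (h𝔪 : (𝔪 : FractionalIdeal (𝓞 K)⁰ K) * (CMTypeLattice.conjIdeal 𝔪 : FractionalIdeal (𝓞 K)⁰ K) =
      spanSingleton (𝓞 K)⁰ α) :
    (∃ ζ' : K, IsCMField.complexConj K ζ' = -ζ' ∧ (∀ φ : Φ.1, 0 < (φ.1 ζ').im) ∧ CMTypeLattice.IsOfType 𝔪 ζ' ⊤) ↔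
      ∃ ζ' : K, IsCMField.complexConj K ζ' = -ζ' ∧ (∀ φ : Φ.1, 0 < (φ.1 ζ').im) ∧
        CMTypeLattice.IsOfType (1 : (FractionalIdeal (𝓞 K)⁰ K)ˣ) ζ' ⊤ := by
  obtain ⟨hreal, hpos⟩ := alpha_real_pos hζ
  obtain ⟨φ₀⟩ := (inferInstance : Nonempty (K →+* ℂ))
  have h0 : α ≠ 0 := fun h => by
    have := hpos φ₀
    rw [h, map_zero, Complex.zero_re] at this
    exact lt_irrefl _ this
  obtain ⟨Φ', hΦ'⟩ := exists_twist Φ hreal h0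
  rw [exists_pos_isOfType_iff_twist Φ Φ' hreal h0 hΦ' 𝔪 h𝔪 ⊤]
  have hmem := mem_twist_iff_of_pos Φ Φ' hΦ' hpos
  constructor
  · rintro ⟨ζ', h1, h2, h3⟩
    exact ⟨ζ', h1, fun φ => h2 ⟨φ.1, (hmem φ.1).mpr φ.2⟩, h3⟩
  · rintro ⟨ζ', h1, h2, h3⟩
    exact ⟨ζ', h1, fun φ => h2 ⟨φ.1, (hmem φ.1).mp φ.2⟩, h3⟩

/-- **On `𝔔` and on `𝔔^ρ` the verdict is the verdict of `ℤ[ζ₅₂]`**, for every CM type `Φ`.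
research route conditional on HC_CM; not a corollary; Q11.4-sentence-2 already refuted in dim ≥ 3. [cite: Shimura1998, §14.4 Prop. 7, p. 105] -/
theorem principal_iff_fiftyTwo_nonprincipal (hζ : IsPrimitiveRoot ζ 52) (Φ : CMType K) (𝔪 : (FractionalIdeal (𝓞 K)⁰ K)ˣ)
    (h : (𝔪 : FractionalIdeal (𝓞 K)⁰ K) = ((𝔔[hζ] : Ideal (𝓞 K)) : FractionalIdeal (𝓞 K)⁰ K) ∨
      (𝔪 : FractionalIdeal (𝓞 K)⁰ K) = ((𝔔ρ[hζ] : Ideal (𝓞 K)) : FractionalIdeal (𝓞 K)⁰ K)) :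
    (∃ ζ' : K, IsCMField.complexConj K ζ' = -ζ' ∧ (∀ φ : Φ.1, 0 < (φ.1 ζ').im) ∧ CMTypeLattice.IsOfType 𝔪 ζ' ⊤) ↔
      ∃ ζ' : K, IsCMField.complexConj K ζ' = -ζ' ∧ (∀ φ : Φ.1, 0 < (φ.1 ζ').im) ∧
        CMTypeLattice.IsOfType (1 : (FractionalIdeal (𝓞 K)⁰ K)ˣ) ζ' ⊤ := by
  rcases h with h | h
  · exact principal_iff_of_mul_conjIdeal_eq hζ Φ 𝔪 (mul_conjIdeal_eq_of_coe_eq hζ 𝔪 h)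
  · exact principal_iff_of_mul_conjIdeal_eq hζ Φ 𝔪 (mul_conjIdeal_eq_of_coe_eq_conj hζ 𝔪 h)

open scoped Classical in
/-- **CENSUS ROW `(ℚ(ζ₅₂), ℚ(i))` ON THE NON-PRINCIPAL CLASSES — YES**: for every CM type `Φ` balanced for
`N_K = {3, 7, 11, 15, 19, 23, 27, 31, 35, 43, 47, 51}` and `𝔪 ∈ {𝔔, 𝔔^ρ}`, `ℂ^Φ/Φ(𝔪)` carries an `ι`-compatible principal
polarisation (part 23's row transported by §3).
research route conditional on HC_CM; not a corollary; Q11.4-sentence-2 already refuted in dim ≥ 3. [cite: Shimura1998, §14.3 Prop. 5, p. 104; §14.4 Prop. 7, p. 105] -/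
theorem exists_principal_nonprincipal_fiftyTwo_sqrt_neg_one [IsCyclotomicExtension {52} ℚ K] (hζ : IsPrimitiveRoot ζ 52)
    (Φ : CMType K)
    (hbal : 2 * ((Finset.univ.filter fun t : ZMod 52 => ∃ σ ∈ Φ.1, σ ζ = 𝐞 t) ∩
        ({3, 7, 11, 15, 19, 23, 27, 31, 35, 43, 47, 51} : Finset (ZMod 52))).card =
      (Finset.univ.filter fun t : ZMod 52 => ∃ σ ∈ Φ.1, σ ζ = 𝐞 t).card)
    (𝔪 : (FractionalIdeal (𝓞 K)⁰ K)ˣ)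
    (h : (𝔪 : FractionalIdeal (𝓞 K)⁰ K) = ((𝔔[hζ] : Ideal (𝓞 K)) : FractionalIdeal (𝓞 K)⁰ K) ∨
      (𝔪 : FractionalIdeal (𝓞 K)⁰ K) = ((𝔔ρ[hζ] : Ideal (𝓞 K)) : FractionalIdeal (𝓞 K)⁰ K)) :
    ∃ ζ' : K, IsCMField.complexConj K ζ' = -ζ' ∧ (∀ φ : Φ.1, 0 < (φ.1 ζ').im) ∧ CMTypeLattice.IsOfType 𝔪 ζ' ⊤ :=
  (principal_iff_fiftyTwo_nonprincipal hζ Φ 𝔪 h).mpr (exists_principal_fiftyTwo_sqrt_neg_one hζ Φ hbal)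

open scoped Classical in
/-- **CENSUS ROW `(ℚ(ζ₅₂), ℚ(√−13))` ON THE NON-PRINCIPAL CLASSES — YES**: for every CM type `Φ` balanced for
`N_K = {3, 5, 21, 23, 27, 33, 35, 37, 41, 43, 45, 51}` and `𝔪 ∈ {𝔔, 𝔔^ρ}`.
research route conditional on HC_CM; not a corollary; Q11.4-sentence-2 already refuted in dim ≥ 3. [cite: Shimura1998, §14.3 Prop. 5, p. 104; §14.4 Prop. 7, p. 105] -/
theorem exists_principal_nonprincipal_fiftyTwo_sqrt_neg_thirteen [IsCyclotomicExtension {52} ℚ K]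
    (hζ : IsPrimitiveRoot ζ 52) (Φ : CMType K)
    (hbal : 2 * ((Finset.univ.filter fun t : ZMod 52 => ∃ σ ∈ Φ.1, σ ζ = 𝐞 t) ∩
        ({3, 5, 21, 23, 27, 33, 35, 37, 41, 43, 45, 51} : Finset (ZMod 52))).card =
      (Finset.univ.filter fun t : ZMod 52 => ∃ σ ∈ Φ.1, σ ζ = 𝐞 t).card)
    (𝔪 : (FractionalIdeal (𝓞 K)⁰ K)ˣ)
    (h : (𝔪 : FractionalIdeal (𝓞 K)⁰ K) = ((𝔔[hζ] : Ideal (𝓞 K)) : FractionalIdeal (𝓞 K)⁰ K) ∨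
      (𝔪 : FractionalIdeal (𝓞 K)⁰ K) = ((𝔔ρ[hζ] : Ideal (𝓞 K)) : FractionalIdeal (𝓞 K)⁰ K)) :
    ∃ ζ' : K, IsCMField.complexConj K ζ' = -ζ' ∧ (∀ φ : Φ.1, 0 < (φ.1 ζ').im) ∧ CMTypeLattice.IsOfType 𝔪 ζ' ⊤ :=
  (principal_iff_fiftyTwo_nonprincipal hζ Φ 𝔪 h).mpr (exists_principal_fiftyTwo_sqrt_neg_thirteen hζ Φ hbal)

end Summit.HodgeConjecture.Ring2WeilCoverage.NonPrincipalLatticeLevel52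

end
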